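import Summits.HodgeConjecture.HodgeConjecture.Theorems.Ring2WeilCoverageFullSignature
import Summits.HodgeConjecture.HodgeConjecture.Theorems.Ring2WeilCoverageCyclotomicSignaturesLevel32
import HarnessLib

/-!
# Weil-type family coverage — LEVEL 32: the units of `ℚ(ζ₃₂)⁺` have EVERY signature (THEOREM L (i) FAILS: a unit of
# norm `−1`), hence EVERY polarisation type occurs on EVERY CM torus `ℂ^Φ/D(𝔪)` of `ℚ(ζ₃₂)` — the census rows
# `(32, ℚ(i))`, `(32, ℚ(√−2))` carry every principal type `(ϖ₀)`, both norm signs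

research route conditional on HC_CM; not a corollary; Q11.4-sentence-2 already refuted in dim ≥ 3.

Ring 2, WEIL-TYPE FAMILY-COVERAGE CENSUS (`HOME/WEIL-FAMILY-COVERAGE.md` `## b01`, blocks b01.23 (D), b01.28 THEOREM L,
b01.42 (the norm-sign law: level `32` one-sided); owner ring2-b01), part 61 of the `Ring2WeilCoverage*` series.  Part 22
(`…CyclotomicSignaturesLevel32`) proved THEOREM L (ii) at the prime-power level `32` with the geometric-sum units
`v(a, c) = ζ^c(1 + ζ + ⋯ + ζ^{a−1})` (sign law `32 < at mod 64`) and remarked that they have FULL sign rank `8`; part 56d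
(`…TypeNormSignLevelsG8A`) could therefore only state the existence half «`N(ϖ₀) > 0` ⇒ type `(ϖ₀)`» at `32`.  Here the
full rank is put to use through part 60 (`…FullSignature`):

* `oddWitness_thirtyTwo` (`decide +kernel`): the signed product `−v(5,30)v(9,28)v(15,25)` is negative EXACTLY at the
  places reading `t = ±1`; `exists_units_neg_iff_thirtyTwo`: so some unit of `𝓞 K` fixed by `ρ` is negative exactly
  there (part 22's family property); `ncard_negSet_eq_one_of_sign_iff` (any level `n`): such a unit is negative at
  exactly ONE member of every CM type.
* **`forall_exists_units_sign_eq_thirtyTwo`** — EVERY sign pattern on every CM type of `ℚ(ζ₃₂)` is a real unit's;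
  **`exists_realUnits_norm_neg_thirtyTwo`** / **`not_forall_norm_realUnits_pos_thirtyTwo`** — a unit of `𝓞(ℚ(ζ₃₂)⁺)`
  has norm `−1`: THEOREM L (i) FAILS at `32` (the only census level where it does; cf. parts 8/9/10/31/57 and 63).
* **`exists_pos_isOfType_thirtyTwo`** — for EVERY CM type `Φ`, lattice `𝔪` and type `𝔣₀` carried by a skew `ζ₀ ≠ 0`,
  `ℂ^Φ/D(𝔪)` carries a `Φ`-positive divisor of type `(K; Φ; 𝔣₀)`; **`exists_principal_thirtyTwo'`** (an
  `ι`-compatible PRINCIPAL polarisation on `ℂ^Φ/Φ(ℤ[ζ₃₂])` for EVERY `Φ`, balanced or not) and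
  **`exists_type_span_thirtyTwo`** (EVERY principal type `(ϖ₀)`, `ϖ₀ ∈ 𝓞 K⁺ ∖ 0`, on `ℂ^Φ/Φ(ℤ[ζ₃₂])`, every `Φ`,
  both signs of `N_{K⁺/ℚ}(ϖ₀)`) — in particular on the census rows `(32, ℚ(i))`, `(32, ℚ(√−2))` the one-sided
  statements of part 56d hold WITHOUT the hypothesis `N(ϖ₀) > 0`.

HONEST FRAMING: torus-level statements about Shimura's divisors of type `(K; Φ; 𝔣₀)` [Sh98 §14.3 Prop. 4–5] and
units of `𝓞 K`; nothing here is a statement about Hodge classes, `W_K`, general members or HC; `HC_CM` is used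
nowhere.  No `def`, no named fact, no `sorry`.

References: [cite: Shimura1998, §14.3 Prop. 4–5, pp. 103–104]; [cite: Washington1997, §8.1, Lemma 8.1]; census
b01.23 (D) / b01.28 / b01.42 (seat-derived).
-/

noncomputable section

open Polynomial NumberField Complex Finset
open scoped Real nonZeroDivisors

namespace Summit.HodgeConjecture.Ring2WeilCoverage.FullSignatureLevel32

open Literature.AlgebraicGeometry.Motives (CMType)
open Literature.AlgebraicGeometry.HodgeTheory (IsCMTypeSet)
open Literature.NumberTheory.ComplexMultiplication
open Literature.AlgebraicGeometry.ComplexMultiplication.CyclotomicCMType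
  (exists_apply_eq_toCircle embedding_eq_of_apply_eq exists_embedding_apply_eq_toCircle
    conjugate_apply_eq_toCircle_neg exists_cmType_iff_mem)
open Summit.HodgeConjecture.Ring2WeilCoverage.CyclotomicSignaturesLevel32
  (familyProperty_thirtyTwo exists_units_sign_eq_thirtyTwo)
open Summit.HodgeConjecture.Ring2WeilCoverage.FullSignature

variable {K : Type} [Field K] [NumberField K] {ζ : K}

/-- `𝐞(t) = exp(2πi t/n) ∈ ℂ` (`ZMod.toCircle`). -/
local notation3 (prettyPrint := false) "𝐞 " t:max => ((ZMod.toCircle t : Circle) : ℂ)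

/-! ### §1 A real unit negative at exactly one member of every CM type (any level) -/

section AnyLevel

variable {n : ℕ} [NeZero n]

/-- **A real element negative exactly at the places reading `±1` is negative at exactly ONE member of every CM type**
of `ℚ(ζₙ)`: the member reading `1` or the member reading `−1` (exactly one of the embedding `φ₁ : ζ ↦ 𝐞(1)` and its
conjugate `φ̄₁ : ζ ↦ 𝐞(−1)` lies in `Φ`).
research route conditional on HC_CM; not a corollary; Q11.4-sentence-2 already refuted in dim ≥ 3. [folklore] -/
theorem ncard_negSet_eq_one_of_sign_iff [IsCyclotomicExtension {n} ℚ K] (hζ : IsPrimitiveRoot ζ n) (Φ : CMType K)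
    {u : K} (hsign : ∀ (φ : K →+* ℂ) (t : ZMod n), φ ζ = 𝐞 t → t.val.Coprime n →
      (((φ u).re < 0) ↔ (t = 1 ∨ t = -1))) :
    (Φ.1 ∩ {ψ : K →+* ℂ | (ψ u).re < 0}).ncard = 1 := by
  classical
  have h1 : (1 : ZMod n).val.Coprime n := by
    rw [ZMod.val_one_eq_one_mod]
    rcases Nat.lt_or_ge 1 n with hn | hn
    · rw [Nat.mod_eq_of_lt hn]; exact Nat.coprime_one_left n
    · have : n = 1 := le_antisymm hn (NeZero.pos n)
      subst this; simp
  obtain ⟨φ₁, hφ₁⟩ := exists_embedding_apply_eq_toCircle hζ 1 h1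
  have hφ₁' : ComplexEmbedding.conjugate φ₁ ζ = 𝐞 (-1) := conjugate_apply_eq_toCircle_neg hφ₁
  -- the member of `Φ` among `φ₁`, `φ̄₁`
  obtain ⟨φ₀, hφ₀Φ, hφ₀⟩ : ∃ φ₀ : K →+* ℂ, φ₀ ∈ Φ.1 ∧ (φ₀ = φ₁ ∨ φ₀ = ComplexEmbedding.conjugate φ₁) := by
    by_cases hmem : φ₁ ∈ Φ.1
    · exact ⟨φ₁, hmem, Or.inl rfl⟩
    · exact ⟨ComplexEmbedding.conjugate φ₁, not_not.mp fun h => hmem ((Φ.2 φ₁).mpr h), Or.inr rfl⟩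
  rw [Set.ncard_eq_one]
  refine ⟨φ₀, Set.eq_singleton_iff_unique_mem.mpr ⟨⟨hφ₀Φ, ?_⟩, fun φ hφ => ?_⟩⟩
  · -- `φ₀` reads `±1`, so `u` is negative there
    rcases hφ₀ with rfl | rfl
    · exact (hsign _ 1 hφ₁ h1).mpr (Or.inl rfl)
    · refine (hsign _ (-1) hφ₁' ?_).mpr (Or.inr rfl)
      obtain ⟨t, ht, hread⟩ := exists_apply_eq_toCircle hζ (ComplexEmbedding.conjugate φ₁)
      have : t = -1 := ZMod.injective_toCircle (Circle.ext (hread.symm.trans hφ₁'))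
      subst this; exact ht
  · -- a member of `Φ` where `u` is negative reads `±1`, hence is `φ₁` or `φ̄₁`, hence is `φ₀`
    obtain ⟨hφΦ, hneg⟩ := hφ
    obtain ⟨t, ht, hread⟩ := exists_apply_eq_toCircle hζ φ
    have hneg' : (φ u).re < 0 := hneg
    rcases (hsign φ t hread ht).mp hneg' with rfl | rfl
    · have e : φ = φ₁ := embedding_eq_of_apply_eq hζ (hread.trans hφ₁.symm)
      subst e
      rcases hφ₀ with rfl | rfl
      · rfl
      · exact absurd hφ₀Φ ((Φ.2 φ).mp hφΦ)
    · have e : φ = ComplexEmbedding.conjugate φ₁ := embedding_eq_of_apply_eq hζ (hread.trans hφ₁'.symm)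
      subst e
      rcases hφ₀ with rfl | rfl
      · exact absurd hφΦ ((Φ.2 _).mp hφ₀Φ)
      · rfl

end AnyLevel

/-! ### §2 Level `32`: the odd witness -/

/-- the sign law of the geometric-sum unit `v(a,c)` at the unit residue `t` (part 20): `32 < at mod 64`. -/
local notation3 (prettyPrint := false) "negAtG" =>
  (fun (x : ℕ × ℕ) (t : ZMod 32) => 32 < x.1 * ZMod.val t % (2 * 32))

/-- admissibility of a pair `(a, c)` (part 20): `a` prime to `32`, `(2c + a − 1) mod 64 = 0`, `a ≥ 1`. -/
local notation3 (prettyPrint := false) "admG" =>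
  (fun x : ℕ × ℕ => Nat.Coprime x.1 32 ∧ (2 * x.2 + x.1 - 1) % (2 * 32) = 0 ∧ 1 ≤ x.1)

/-- the sign pattern of the signed product `(A, ε)` at `t`. -/
local notation3 (prettyPrint := false) "pat " A:max ε:max t:max =>
  Odd ((Finset.filter (fun x : ℕ × ℕ => negAtG x t) A).card + (if (ε : Bool) then 1 else 0))

/-- **The odd witness at level 32** (`decide +kernel`): the admissible signed product
`−v(5,30)·v(9,28)·v(15,25)` of geometric-sum units is negative EXACTLY at the two unit residues `t = ±1` — one real
place of `ℚ(ζ₃₂)⁺` out of eight, an ODD number.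
research route conditional on HC_CM; not a corollary; Q11.4-sentence-2 already refuted in dim ≥ 3. [folklore] -/
theorem oddWitness_thirtyTwo :
    (∀ x ∈ ({(5, 30), (9, 28), (15, 25)} : Finset (ℕ × ℕ)), admG x) ∧
      ∀ t ∈ (Finset.univ.filter fun t : ZMod 32 => t.val.Coprime 32),
        (pat ({(5, 30), (9, 28), (15, 25)} : Finset (ℕ × ℕ)) true t ↔ (t = 1 ∨ t = -1)) := by
  decide +kernel

/-- **A unit of `𝓞(ℚ(ζ₃₂))` fixed by `ρ` negative exactly at the places reading `±1`** (part 22's family property on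
the odd witness).
research route conditional on HC_CM; not a corollary; Q11.4-sentence-2 already refuted in dim ≥ 3. [cite: Washington1997, §8.1, Lemma 8.1] -/
theorem exists_units_neg_iff_thirtyTwo [IsCMField K] (hζ : IsPrimitiveRoot ζ 32) :
    ∃ u : (𝓞 K)ˣ, IsCMField.complexConj K ((u : 𝓞 K) : K) = ((u : 𝓞 K) : K) ∧
      ∀ (φ : K →+* ℂ) (t : ZMod 32), φ ζ = 𝐞 t → t.val.Coprime 32 →
        (((φ ((u : 𝓞 K) : K)).re < 0) ↔ (t = 1 ∨ t = -1)) := by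
  obtain ⟨hA, hP⟩ := oddWitness_thirtyTwo
  obtain ⟨u, hu, hsign⟩ := familyProperty_thirtyTwo hζ {(5, 30), (9, 28), (15, 25)} hA true
  exact ⟨u, hu, fun φ t hφ ht =>
    (hsign φ t hφ ht).trans (hP t (Finset.mem_filter.mpr ⟨Finset.mem_univ _, ht⟩))⟩

/-- **A real unit of `ℚ(ζ₃₂)` negative at exactly ONE member of every CM type** (§1 + the odd witness).
research route conditional on HC_CM; not a corollary; Q11.4-sentence-2 already refuted in dim ≥ 3. [folklore] -/
theorem exists_units_ncard_negSet_eq_one_thirtyTwo [IsCMField K] [IsCyclotomicExtension {32} ℚ K]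
    (hζ : IsPrimitiveRoot ζ 32) :
    ∃ u : (𝓞 K)ˣ, IsCMField.complexConj K ((u : 𝓞 K) : K) = ((u : 𝓞 K) : K) ∧
      ∀ Φ : CMType K, (Φ.1 ∩ {ψ : K →+* ℂ | (ψ ((u : 𝓞 K) : K)).re < 0}).ncard = 1 := by
  obtain ⟨u, hu, hsign⟩ := exists_units_neg_iff_thirtyTwo hζ
  exact ⟨u, hu, fun Φ => ncard_negSet_eq_one_of_sign_iff hζ Φ hsign⟩

/-! ### §3 Level `32`: every signature, a unit of norm `−1`, every type -/

open scoped Classical in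
/-- **EVERY SIGN PATTERN ON EVERY CM TYPE OF `ℚ(ζ₃₂)` IS A REAL UNIT'S** (the units of `ℚ(ζ₃₂)⁺` have all `2⁸`
signatures): part 22's THEOREM L (ii) at `32` + the odd unit of §2, through part 60 `forall_exists_units_sign_eq_of_odd`.
research route conditional on HC_CM; not a corollary; Q11.4-sentence-2 already refuted in dim ≥ 3. [cite: Washington1997, §8.1, Lemma 8.1] -/
theorem forall_exists_units_sign_eq_thirtyTwo [IsCMField K] [IsCyclotomicExtension {32} ℚ K]
    (hζ : IsPrimitiveRoot ζ 32) (Φ : CMType K) (S : Set (K →+* ℂ)) (hS : S ⊆ Φ.1) :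
    ∃ u : (𝓞 K)ˣ, IsCMField.complexConj K ((u : 𝓞 K) : K) = ((u : 𝓞 K) : K) ∧
      ∀ φ ∈ Φ.1, ((φ ((u : 𝓞 K) : K)).re < 0 ↔ φ ∈ S) := by
  obtain ⟨u₁, hu₁, hone⟩ := exists_units_ncard_negSet_eq_one_thirtyTwo hζ
  exact forall_exists_units_sign_eq_of_odd Φ (exists_units_sign_eq_thirtyTwo hζ Φ) hu₁
    (by rw [hone Φ]; exact odd_one) S hS

open scoped Classical in
/-- **THEOREM L (i) FAILS AT `32`: a unit of `𝓞(ℚ(ζ₃₂)⁺)` has NEGATIVE norm** (`N_{ℚ(ζ₃₂)⁺/ℚ}(v) = −1`; e.g.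
`1 − ζ − ζ⁻¹`, whose minimal polynomial `x⁸ − 8x⁶ + 20x⁴ − 16x² + 2` shifted takes the value `−1` — here obtained from
the full signature, part 60 `exists_realUnits_norm_neg_of_forall_sign`).
research route conditional on HC_CM; not a corollary; Q11.4-sentence-2 already refuted in dim ≥ 3. [folklore] -/
theorem exists_realUnits_norm_neg_thirtyTwo [IsCMField K] [IsCyclotomicExtension {32} ℚ K]
    (hζ : IsPrimitiveRoot ζ 32) :
    ∃ v : (𝓞 (maximalRealSubfield K))ˣ,
      Algebra.norm ℚ (((v : 𝓞 (maximalRealSubfield K)) : maximalRealSubfield K)) < 0 := by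
  have hT : IsCMTypeSet 32 ({1, 3, 5, 7, 9, 11, 13, 15} : Finset (ZMod 32)) := by decide
  obtain ⟨Φ, -⟩ := exists_cmType_iff_mem (K := K) hζ hT
  exact exists_realUnits_norm_neg_of_forall_sign Φ (forall_exists_units_sign_eq_thirtyTwo hζ Φ)

/-- **THEOREM L (i) FAILS AT `32`**, in the shape of the hypothesis `hN` of parts 2/7/55: NOT every unit of
`𝓞(ℚ(ζ₃₂)⁺)` has positive norm.
research route conditional on HC_CM; not a corollary; Q11.4-sentence-2 already refuted in dim ≥ 3. [folklore] -/
theorem not_forall_norm_realUnits_pos_thirtyTwo [IsCMField K] [IsCyclotomicExtension {32} ℚ K]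
    (hζ : IsPrimitiveRoot ζ 32) :
    ¬ ∀ v : (𝓞 (maximalRealSubfield K))ˣ,
      0 < Algebra.norm ℚ (((v : 𝓞 (maximalRealSubfield K)) : maximalRealSubfield K)) := by
  obtain ⟨v, hv⟩ := exists_realUnits_norm_neg_thirtyTwo hζ
  exact fun h => lt_asymm hv (h v)

open scoped Classical in
/-- **EVERY TYPE OCCURS ON EVERY CM TORUS OF `ℚ(ζ₃₂)`**: for every CM type `Φ`, lattice `𝔪` and type `𝔣₀` carried by a
skew `ζ₀ ≠ 0` (`IsOfType 𝔪 ζ₀ 𝔣₀`), the torus `ℂ^Φ/D(𝔪)` carries a `Φ`-positive divisor of type `(K; Φ; 𝔣₀)` — an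
`ι`-compatible polarisation with `φ_X` the `𝔬𝔣₀`-multiplication [Sh98 §14.3 Prop. 4].
research route conditional on HC_CM; not a corollary; Q11.4-sentence-2 already refuted in dim ≥ 3. [cite: Shimura1998, §14.3 Prop. 4–5, pp. 103–104] -/
theorem exists_pos_isOfType_thirtyTwo [IsCMField K] [IsCyclotomicExtension {32} ℚ K] (hζ : IsPrimitiveRoot ζ 32)
    (Φ : CMType K) (𝔪 : (FractionalIdeal (𝓞 K)⁰ K)ˣ) {ζ₀ : K} {𝔣₀ : Ideal (𝓞 (maximalRealSubfield K))}
    (hζ₀ : IsCMField.complexConj K ζ₀ = -ζ₀) (h0 : ζ₀ ≠ 0) (hT : CMTypeLattice.IsOfType 𝔪 ζ₀ 𝔣₀) :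
    ∃ ζ' : K, IsCMField.complexConj K ζ' = -ζ' ∧ (∀ φ : Φ.1, 0 < (φ.1 ζ').im) ∧
        CMTypeLattice.IsOfType 𝔪 ζ' 𝔣₀ :=
  exists_pos_isOfType_of_forall_sign Φ 𝔪 hζ₀ h0 hT (forall_exists_units_sign_eq_thirtyTwo hζ Φ)

open scoped Classical in
/-- **A PRINCIPAL polarisation on `ℂ^Φ/Φ(ℤ[ζ₃₂])` for EVERY CM type `Φ`** of `ℚ(ζ₃₂)` — balanced or not, with no
parity condition (part 22's `exists_principal_thirtyTwo_…` needed `Φ` balanced with `n₋` even).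
research route conditional on HC_CM; not a corollary; Q11.4-sentence-2 already refuted in dim ≥ 3. [cite: Shimura1998, §14.3 Prop. 5, p. 104] -/
theorem exists_principal_thirtyTwo' [IsCMField K] [IsCyclotomicExtension {32} ℚ K] (hζ : IsPrimitiveRoot ζ 32)
    (Φ : CMType K) :
    ∃ ζ' : K, IsCMField.complexConj K ζ' = -ζ' ∧ (∀ φ : Φ.1, 0 < (φ.1 ζ').im) ∧
        CMTypeLattice.IsOfType (1 : (FractionalIdeal (𝓞 K)⁰ K)ˣ) ζ' ⊤ :=
  exists_principal_of_forall_sign hζ (k := 7) (by decide) Φ (forall_exists_units_sign_eq_thirtyTwo hζ Φ)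

open scoped Classical in
/-- **EVERY PRINCIPAL TYPE `(ϖ₀)` ON `ℂ^Φ/Φ(ℤ[ζ₃₂])`, EVERY `Φ`, BOTH NORM SIGNS**: for every CM type `Φ` of `ℚ(ζ₃₂)`
and every real `ϖ₀ ∈ 𝓞 K⁺ ∖ 0` there is a skew `Φ`-positive `ζ′` with `IsOfType 1 ζ′ (ϖ₀)` — an `ι`-compatible
polarisation of degree `|N_{K⁺/ℚ}(ϖ₀)|`.  In particular the census rows `(32, ℚ(i))`, `(32, ℚ(√−2))` of part 56d hold
without the hypothesis `N_{K⁺/ℚ}(ϖ₀) > 0` (and without balance): level `32` is the census level where the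
norm-sign law degenerates — every type occurs.
research route conditional on HC_CM; not a corollary; Q11.4-sentence-2 already refuted in dim ≥ 3. [cite: Shimura1998, §14.3 Prop. 4–5, pp. 103–104] -/
theorem exists_type_span_thirtyTwo [IsCMField K] [IsCyclotomicExtension {32} ℚ K] (hζ : IsPrimitiveRoot ζ 32)
    (Φ : CMType K) {ϖ₀ : 𝓞 (maximalRealSubfield K)} (hϖ0 : ϖ₀ ≠ 0) :
    ∃ ζ' : K, IsCMField.complexConj K ζ' = -ζ' ∧ (∀ φ : Φ.1, 0 < (φ.1 ζ').im) ∧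
        CMTypeLattice.IsOfType (1 : (FractionalIdeal (𝓞 K)⁰ K)ˣ) ζ' (Ideal.span {ϖ₀}) :=
  exists_type_span_of_forall_sign hζ (k := 7) (by decide) Φ hϖ0 (forall_exists_units_sign_eq_thirtyTwo hζ Φ)

end Summit.HodgeConjecture.Ring2WeilCoverage.FullSignatureLevel32

end
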